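import Literature.NumberTheory.EllipticCurves.TwoIsogenySelmerXCubeAddPXShaTwo
import Literature.NumberTheory.EllipticCurves.Zywina2025RankTwo
import Literature.NumberTheory.EllipticCurves.CanonicalPAdicHeightAdmissibilityCriteria
import Literature.NumberTheory.EllipticCurves.MordellWeilTheoremProofs
import Literature.NumberTheory.EllipticCurves.ComplexMultiplicationHasCMProofs
import Literature.NumberTheory.EllipticCurves.SelmerCorankHolds
import Literature.NumberTheory.EllipticCurves.BSDSelmerPConverseYanZhuShaFiniteCoreProofs

/-!
# BirchSwinnertonDyer / ShaPrimaryTransfer — crux `OneFiniteShaComponent` (stmt-BirchSwinnertonDyer-22357):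
# the door at 2 is open in the kernel at ranks 0, 1, 2 (unconditional)

Route `ShaPrimaryTransfer` (D-0145 LINE 2) splits KatoTransfer's X1 into the transfer T (stmt-22356) and the DOOR
O = `OneFiniteShaComponent` (stmt-22357: every elliptic `E/ℚ` has SOME prime `p₀` — `2` and `3` allowed — with
`t_{p₀}(E) = corank_{ℤ_{p₀}} Ш(E)[p₀^∞] = 0`), to be decided CURVE BY CURVE by complete descent at a small prime.
This helper file (prover seat `bsd-line-spt-p1`, `--supports stmt-22357 --as helper`; ROUTE-INDEPENDENT: no `Theses`
import, every statement in the O-shape `∃ p, t_p(E) = 0` or sharper) records what the TREE ITSELF decides that way,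
with no named fact and standard axioms:

* §1 THE DOOR LEMMA: `Ш(E)[p] = 0` for one `p` ⟹ `t_p(E) = 0` ⟹ O(E) (`door_of_sha_torsionFree`).
* §2 THE DOOR AT 2 IS OPEN IN THE KERNEL AT EVERY RANK ≤ 2.
  Rank 0: the CM family `E_p : y² = x³ + px`, `p ≡ 7, 11 (mod 16)` (Silverman X.6.2(c), Cor. X.6.2.1 — the
  tree's complete `2`-isogeny descent `XCubeAddPX.rank_eq_zero_and_sha_two_torsion_eq_zero`): `rank = 0`,
  `t_2 = 0`, `corank Sel_{2^∞} = 0`, infinitely many `p`; `j = 1728` (CM by `ℤ[i]`).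
  Rank 1: `E_3 : y² = x³ + 3x` — the same descent gives `rank + dim₂ Ш[φ] = 1` (`p ≡ 3 (mod 16)`), and the
  rational point `(121/9, 1342/27) = 3·(1, −2)` has `‖x‖₃ = 9 > 1`, hence infinite order (`E₁(ℚ₃)` is
  torsion-free, tree `not_isOfFinAddOrder_of_one_lt_norm`), so `rank E_3(ℚ) = 1`, `Ш(E_3)[2] = 0`,
  `t_2(E_3) = 0`, `corank Sel_{2^∞}(E_3) = 1` (`rank_eq_one_and_door_at_two_xCubeAddThreeX`).
  Rank 2: Zywina's `E_{947,12}` (arXiv:2502.01957 Thm. 1.2; tree `Zywina2025RankTwo`: rank `2`, `t_2 = 0`; a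
  second explicit admissible pair, `(659,12)` being certified in `…RankTwoDoor`).
  Synthesis `exists_door_at_two_of_le_two`: for every `r ≤ 2` an elliptic `E/ℚ` with `rank E(ℚ) = r` and
  `t_2(E) = 0`. So the route's instrument (descent at 2) is certified in the kernel at the ranks where O is open
  (rank 2 included), and the HYPOTHESIS of T / of the `2`-converses at the door prime (`corank Sel_{2^∞} = rank`)
  is certified on curves of rank 0, 1, 2; what is certified for NO curve of rank ≥ 2 is the door's consequence
  under T (all `t_q = 0`, i.e. `Ш` finite).

Nothing here proves O, T or BSD; O is conjecture-grade at analytic rank ≥ 2. Companion file `…OneFiniteShaComponentDoors`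
(O against the registered items, Selmer coordinates, GZK slice and residue). References: J. H. Silverman, *AEC* 2nd
ed., X.6 Prop. 6.2, Cor. 6.2.1, Rem. 6.3, VII.3.4, VIII.6.7; D. Zywina, arXiv:2502.01957, Thm. 1.2; R. Greenberg,
LNM 1716 (1999), §1.
-/

-- D-0017: single-problem summit, so `Summit.BirchSwinnertonDyer.BirchSwinnertonDyer.…` repeats a namespace BY DESIGN.
set_option linter.dupNamespace false

noncomputable section

namespace Summit.BirchSwinnertonDyer.BirchSwinnertonDyer.Theorems.ShaPrimaryTransferKernelDoors

open scoped Classical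
open Literature.NumberTheory.EllipticCurves Literature.NumberTheory.EllipticCurves.Zywina2025
open WeierstrassCurve

/-! ## §1 The door lemma -/

/-- **The door lemma.** If `Ш(E/ℚ)` has no `p`-torsion for ONE prime `p` (what a complete `p`-descent with
`#Sel^{(p)} = p^{rank + dim E(ℚ)[p]}` certifies), then `Ш(E)[p^∞] = 0`, `t_p(E) = 0`, and O holds for `E` with
witness `p` (tree theorem `shaCorank_eq_zero_of_forall`). [cite: Greenberg1999LNM, §1 pp. 54–57] -/
theorem door_of_sha_torsionFree (W : WeierstrassCurve ℚ) [W.IsElliptic] (p : ℕ) [hp : Fact p.Prime]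
    (h : ∀ c ∈ W.sha, p • c = 0 → c = 0) : ∃ (q : ℕ) (_ : Fact q.Prime), W.shaCorank q = 0 :=
  ⟨p, hp, W.shaCorank_eq_zero_of_forall p h⟩

/-! ## §2 The door at 2 in the kernel: rank 0 (family), rank 1 (`y² = x³ + 3x`), rank 2 (Zywina) -/

/-! ### Rank 0: `E_p : y² = x³ + px`, `p ≡ 7, 11 (mod 16)` -/

/-- **`t_2(E_p) = 0` for `E_p : y² = x³ + px`, `p ≡ 7, 11 (mod 16)` prime** — UNCONDITIONAL: the tree's complete
`2`-isogeny descent gives `Ш(E_p/ℚ)[2] = 0` (`XCubeAddPX.sha_two_torsion_eq_zero`), hence `Ш(E_p)[2^∞] = 0`.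
[cite: SilvermanAEC2009, Prop. X.6.2(c) and Cor. X.6.2.1] -/
theorem shaCorank_two_xCubeAddPX_eq_zero {p : ℕ} [Fact p.Prime] (h16 : p % 16 = 7 ∨ p % 16 = 11) :
    (⟨0, 0, 0, (p : ℚ), 0⟩ : WeierstrassCurve ℚ).shaCorank 2 = 0 :=
  haveI : Fact (Nat.Prime 2) := ⟨Nat.prime_two⟩
  shaCorank_eq_zero_of_forall _ 2 (XCubeAddPX.sha_two_torsion_eq_zero h16)

/-- **The door at 2 for `E_p`, `p ≡ 7, 11 (mod 16)`: `rank E_p(ℚ) = 0` and `t_2(E_p) = 0`** — decided by descent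
alone, no named fact. [cite: SilvermanAEC2009, Cor. X.6.2.1] -/
theorem door_at_two_xCubeAddPX {p : ℕ} [Fact p.Prime] (h16 : p % 16 = 7 ∨ p % 16 = 11) :
    (⟨0, 0, 0, (p : ℚ), 0⟩ : WeierstrassCurve ℚ).mordellWeilRank = 0 ∧
      (⟨0, 0, 0, (p : ℚ), 0⟩ : WeierstrassCurve ℚ).shaCorank 2 = 0 :=
  ⟨(XCubeAddPX.rank_eq_zero_and_sha_two_torsion_eq_zero h16).1, shaCorank_two_xCubeAddPX_eq_zero h16⟩

/-- **O holds for `E_p : y² = x³ + px`, `p ≡ 7, 11 (mod 16)`**, witness `p₀ = 2`. UNCONDITIONAL.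
[cite: SilvermanAEC2009, Cor. X.6.2.1] -/
theorem oneFiniteShaComponent_xCubeAddPX {p : ℕ} [Fact p.Prime] (h16 : p % 16 = 7 ∨ p % 16 = 11) :
    ∃ (q : ℕ) (_ : Fact q.Prime), (⟨0, 0, 0, (p : ℚ), 0⟩ : WeierstrassCurve ℚ).shaCorank q = 0 :=
  ⟨2, ⟨Nat.prime_two⟩, shaCorank_two_xCubeAddPX_eq_zero h16⟩

/-- **`corank_{ℤ_2} Sel_{2^∞}(E_p/ℚ) = 0`** for `p ≡ 7, 11 (mod 16)` (Greenberg's identity `corank Sel_{2^∞} =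
rank + t_2`, tree `selmerCorank_eq_mordellWeilRank_add_holds`): the HYPOTHESIS of every rank-0 `2`-converse / of T
at the door prime `2`, certified in the kernel on an infinite CM family. UNCONDITIONAL.
[cite: SilvermanAEC2009, Cor. X.6.2.1] [cite: Greenberg1999LNM, §1 pp. 54–57] -/
theorem selmerCorank_two_xCubeAddPX_eq_zero {p : ℕ} [Fact p.Prime] (h16 : p % 16 = 7 ∨ p % 16 = 11) :
    (⟨0, 0, 0, (p : ℚ), 0⟩ : WeierstrassCurve ℚ).selmerCorank 2 = 0 := by
  haveI := XCubeAddPX.isElliptic_px p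
  haveI : Fact (Nat.Prime 2) := ⟨Nat.prime_two⟩
  have hid := (⟨0, 0, 0, (p : ℚ), 0⟩ : WeierstrassCurve ℚ).selmerCorank_eq_mordellWeilRank_add_holds 2
  obtain ⟨hr, ht⟩ := door_at_two_xCubeAddPX h16
  omega

/-- **Infinitely many rank-0 curves are doored at 2 in the kernel** (Dirichlet, `p ≡ 7 (mod 16)`; Cor. X.6.2.1
verbatim says `Ш(E_p/ℚ)[2] = 0`). UNCONDITIONAL. [cite: SilvermanAEC2009, Cor. X.6.2.1] -/
theorem infinite_setOf_prime_rank_zero_door_at_two :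
    {p : ℕ | p.Prime ∧ (⟨0, 0, 0, (p : ℚ), 0⟩ : WeierstrassCurve ℚ).mordellWeilRank = 0 ∧
      (⟨0, 0, 0, (p : ℚ), 0⟩ : WeierstrassCurve ℚ).shaCorank 2 = 0}.Infinite := by
  refine XCubeAddPX.infinite_setOf_prime_rank_zero_and_sha_two.mono ?_
  rintro p ⟨hpr, hr, hsha⟩
  haveI : Fact p.Prime := ⟨hpr⟩
  haveI : Fact (Nat.Prime 2) := ⟨Nat.prime_two⟩
  exact ⟨hpr, hr, shaCorank_eq_zero_of_forall _ 2 hsha⟩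

/-- The curves `E_p : y² = x³ + px` have `j = 1728`, hence complex multiplication (tree `hasCM_of_j_eq_1728`): the
rank-0 door family lies in the CM sector, where the door at ANY prime transfers in rank 0 modulo Burungale–Tian
2026 + GZK (companion file `…Sectors`). [cite: SilvermanAEC2009, X.6 (E_D : y² = x³ + Dx)] -/
theorem hasCM_xCubeAddPX (p : ℕ) [Fact p.Prime] : (⟨0, 0, 0, (p : ℚ), 0⟩ : WeierstrassCurve ℚ).HasCM := by
  haveI := XCubeAddPX.isElliptic_px p
  refine hasCM_of_j_eq_1728 _ ?_
  have hp0 : (p : ℚ) ≠ 0 := by exact_mod_cast (Fact.out : p.Prime).ne_zero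
  have hΔ : (⟨0, 0, 0, (p : ℚ), 0⟩ : WeierstrassCurve ℚ).Δ = -64 * (p : ℚ) ^ 3 := by
    norm_num [WeierstrassCurve.Δ, WeierstrassCurve.b₂, WeierstrassCurve.b₄, WeierstrassCurve.b₆,
      WeierstrassCurve.b₈]; ring
  have hc₄ : (⟨0, 0, 0, (p : ℚ), 0⟩ : WeierstrassCurve ℚ).c₄ = -48 * (p : ℚ) := by
    norm_num [WeierstrassCurve.c₄, WeierstrassCurve.b₂, WeierstrassCurve.b₄]; ring
  rw [WeierstrassCurve.j, Units.val_inv_eq_inv_val, WeierstrassCurve.coe_Δ', hΔ, hc₄]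
  field_simp
  ring

/-! ### Rank 1: `E_3 : y² = x³ + 3x` -/

/-- `E_3 : y² = x³ + 3x` is an elliptic curve (`Δ = −1728`). [cite: SilvermanAEC2009, X.6] -/
theorem isElliptic_xCubeAddThreeX : (⟨0, 0, 0, ((3 : ℕ) : ℚ), 0⟩ : WeierstrassCurve ℚ).IsElliptic :=
  haveI : Fact (Nat.Prime 3) := ⟨Nat.prime_three⟩
  XCubeAddPX.isElliptic_px 3

/-- `E_3` has integer coefficients. [folklore] -/
theorem isIntegral_xCubeAddThreeX : (⟨0, 0, 0, ((3 : ℕ) : ℚ), 0⟩ : WeierstrassCurve ℚ).IsIntegral ℤ :=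
  ⟨⟨⟨0, 0, 0, 3, 0⟩, by ext <;> simp [WeierstrassCurve.baseChange, WeierstrassCurve.map]⟩⟩

/-- `Q = (121/9, 1342/27) = 3·(1, −2)` is a (non-singular) rational point of `E_3 : y² = x³ + 3x`. [folklore] -/
theorem nonsingular_xCubeAddThreeX_Q :
    (⟨0, 0, 0, ((3 : ℕ) : ℚ), 0⟩ : WeierstrassCurve ℚ).toAffine.Nonsingular (121 / 9) (1342 / 27) := by
  haveI := isElliptic_xCubeAddThreeX
  refine WeierstrassCurve.Affine.equation_iff_nonsingular.mp ?_
  rw [WeierstrassCurve.Affine.equation_iff]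
  norm_num

/-- `‖121/9‖₃ = 9 > 1`: `Q` lies in `E₁(ℚ₃)`. [folklore] -/
theorem one_lt_norm_xCubeAddThreeX_Qx : 1 < ‖((121 / 9 : ℚ) : ℚ_[3])‖ := by
  haveI : Fact (Nat.Prime 3) := ⟨Nat.prime_three⟩
  have hval : padicValRat 3 (121 / 9 : ℚ) = -2 := by
    rw [show (121 / 9 : ℚ) = ((121 : ℕ) : ℚ) / ((9 : ℕ) : ℚ) by norm_num,
      padicValRat.div (by norm_num) (by norm_num), padicValRat.of_nat, padicValRat.of_nat,
      padicValNat.eq_zero_of_not_dvd (by norm_num), show (9 : ℕ) = 3 ^ 2 by norm_num,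
      padicValNat.prime_pow]
    norm_num
  rw [Padic.eq_padicNorm, padicNorm.eq_zpow_of_nonzero (by norm_num), hval]
  norm_num

/-- **`Q` has infinite order in `E_3(ℚ)`**: a rational point with `‖x‖_p > 1` at an odd prime `p` is non-torsion
on any `ℤ`-integral model (`E₁(ℚ_p)` torsion-free; tree `not_isOfFinAddOrder_of_one_lt_norm`).
[cite: SilvermanAEC2009, VII.3.4] -/
theorem not_isOfFinAddOrder_xCubeAddThreeX_Q :
    ¬ IsOfFinAddOrder (.some (121 / 9) (1342 / 27) nonsingular_xCubeAddThreeX_Q :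
      (⟨0, 0, 0, ((3 : ℕ) : ℚ), 0⟩ : WeierstrassCurve ℚ).toAffine.Point) :=
  haveI : Fact (Nat.Prime 3) := ⟨Nat.prime_three⟩
  haveI := isIntegral_xCubeAddThreeX
  not_isOfFinAddOrder_of_one_lt_norm (p := 3) le_rfl nonsingular_xCubeAddThreeX_Q
    one_lt_norm_xCubeAddThreeX_Qx

/-- `rank E_3(ℚ) ≥ 1`: the multiples `n • Q` are pairwise distinct (Mathlib `injective_nsmul_iff_not_isOfFinAddOrder`),
so `E_3(ℚ)` is infinite, hence of positive rank (Mordell–Weil; tree `one_le_mordellWeilRank_of_infinite_point`).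
[cite: SilvermanAEC2009, Thm. VIII.6.7] -/
theorem one_le_mordellWeilRank_xCubeAddThreeX :
    1 ≤ (⟨0, 0, 0, ((3 : ℕ) : ℚ), 0⟩ : WeierstrassCurve ℚ).mordellWeilRank := by
  haveI := isElliptic_xCubeAddThreeX
  exact one_le_mordellWeilRank_of_infinite_point _
    (Infinite.of_injective _ (injective_nsmul_iff_not_isOfFinAddOrder.mpr not_isOfFinAddOrder_xCubeAddThreeX_Q))

/-- **`rank E_3(ℚ) = 1` and `Ш(E_3/ℚ)[φ] = 0`**: the tree's `2`-isogeny descent for `p ≡ 3 (mod 16)` gives «`rank = 0`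
and `#Ш[φ] = 2`, or `rank = 1` and `Ш[φ] = 0`» (`XCubeAddPX.rank_and_natCard_sha_of_selmerRank_two`); the point of
infinite order excludes the first alternative (Rem. X.6.3). UNCONDITIONAL. [cite: SilvermanAEC2009, Prop. X.6.2(c), Rem. X.6.3] -/
theorem rank_eq_one_and_sha_inf_range_eq_bot_xCubeAddThreeX
    [hE : (⟨0, 0, 0, ((3 : ℕ) : ℚ), 0⟩ : WeierstrassCurve ℚ).IsElliptic] :
    (⟨0, 0, 0, ((3 : ℕ) : ℚ), 0⟩ : WeierstrassCurve ℚ).mordellWeilRank = 1 ∧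
      (⟨0, 0, 0, ((3 : ℕ) : ℚ), 0⟩ : WeierstrassCurve ℚ).sha ⊓
        (⟨0, 0, 0, ((3 : ℕ) : ℚ), 0⟩ : WeierstrassCurve ℚ).twoIsogenyTorsorHom.range = ⊥ := by
  haveI : Fact (Nat.Prime 3) := ⟨Nat.prime_three⟩
  have h1 := one_le_mordellWeilRank_xCubeAddThreeX
  rcases XCubeAddPX.rank_and_natCard_sha_of_selmerRank_two (p := 3) (Or.inr (Or.inl rfl)) with
    ⟨h0, -⟩ | ⟨hr, hN⟩
  · omega
  · exact ⟨hr, (AddSubgroup.card_eq_one).mp hN⟩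

/-- The tree's cast literal `E_{0,3}` is `E_3`. [folklore] -/
private theorem lit_E3 : (⟨0, ((0 : ℤ) : ℚ), 0, (((3 : ℕ) : ℤ) : ℚ), 0⟩ : WeierstrassCurve ℚ) =
    ⟨0, 0, 0, ((3 : ℕ) : ℚ), 0⟩ := by
  push_cast; rfl

/-- The tree's half-model literal for `(a, b) = (0, 3)` is `⟨0, 0, 0, −3/4, 0⟩`. [folklore] -/
private theorem lit_V3 :
    (⟨0, -((0 : ℤ) : ℚ) / 2, 0, (((0 : ℤ) : ℚ) ^ 2 - 4 * (((3 : ℕ) : ℤ) : ℚ)) / 16, 0⟩ : WeierstrassCurve ℚ) =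
      ⟨0, 0, 0, -((3 : ℕ) : ℚ) / 4, 0⟩ := by
  ext <;> push_cast <;> ring

/-- Transport of `Ш(X) ∩ im Ξ_X = ⊥` along an equality of curve literals. [folklore] -/
private theorem sha_inf_range_eq_bot_congr {X Y : WeierstrassCurve ℚ}
    [X.IsTwoTorsionNF] [X.IsElliptic] [Y.IsTwoTorsionNF] [Y.IsElliptic] (h : X = Y) :
    X.sha ⊓ X.twoIsogenyTorsorHom.range = ⊥ ↔ Y.sha ⊓ Y.twoIsogenyTorsorHom.range = ⊥ := by
  subst h
  exact Iff.rfl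

/-- **`Ш(E_3/ℚ)[2] = 0`**: `Ш(E_3')[φ̂] = 0` (`XCubeAddPX.sha_quarterModel_inf_range_eq_bot`, every `p`) and
`Ш(E_3)[φ] = 0` (previous theorem), so `Ш(E_3)[2] = 0` by `φ̂ ∘ φ = [2]` (tree
`forall_mem_sha_two_smul_eq_zero_of_halfModel`). UNCONDITIONAL. [cite: SilvermanAEC2009, Thm. X.4.2(a), Prop. X.6.2(c)] -/
theorem sha_two_torsion_eq_zero_xCubeAddThreeX :
    ∀ c ∈ (⟨0, 0, 0, ((3 : ℕ) : ℚ), 0⟩ : WeierstrassCurve ℚ).sha, 2 • c = 0 → c = 0 := by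
  haveI : Fact (Nat.Prime 3) := ⟨Nat.prime_three⟩
  haveI hE := isElliptic_xCubeAddThreeX
  haveI hV := XCubeAddPX.isElliptic_quarterModel 3
  haveI hV₀ : (⟨0, -((0 : ℤ) : ℚ) / 2, 0, (((0 : ℤ) : ℚ) ^ 2 - 4 * (((3 : ℕ) : ℤ) : ℚ)) / 16, 0⟩ :
      WeierstrassCurve ℚ).IsElliptic := by rw [lit_V3]; exact hV
  haveI hE' : (⟨0, ((0 : ℤ) : ℚ), 0, (((3 : ℕ) : ℤ) : ℚ), 0⟩ : WeierstrassCurve ℚ).IsElliptic := by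
    rw [lit_E3]; exact hE
  have h₀ : (⟨0, -((0 : ℤ) : ℚ) / 2, 0, (((0 : ℤ) : ℚ) ^ 2 - 4 * (((3 : ℕ) : ℤ) : ℚ)) / 16, 0⟩ :
        WeierstrassCurve ℚ).sha ⊓
      (⟨0, -((0 : ℤ) : ℚ) / 2, 0, (((0 : ℤ) : ℚ) ^ 2 - 4 * (((3 : ℕ) : ℤ) : ℚ)) / 16, 0⟩ :
        WeierstrassCurve ℚ).twoIsogenyTorsorHom.range = ⊥ :=
    (sha_inf_range_eq_bot_congr lit_V3).mpr (XCubeAddPX.sha_quarterModel_inf_range_eq_bot 3)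
  have h₁ : (⟨0, ((0 : ℤ) : ℚ), 0, (((3 : ℕ) : ℤ) : ℚ), 0⟩ : WeierstrassCurve ℚ).sha ⊓
      (⟨0, ((0 : ℤ) : ℚ), 0, (((3 : ℕ) : ℤ) : ℚ), 0⟩ : WeierstrassCurve ℚ).twoIsogenyTorsorHom.range = ⊥ :=
    (sha_inf_range_eq_bot_congr lit_E3).mpr rank_eq_one_and_sha_inf_range_eq_bot_xCubeAddThreeX.2
  have h := forall_mem_sha_two_smul_eq_zero_of_halfModel (a := 0) (b := ((3 : ℕ) : ℤ)) h₀ h₁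
  rw [lit_E3] at h
  exact h

/-- **The door at 2 at rank 1: `rank E_3(ℚ) = 1` and `t_2(E_3) = 0`** for `E_3 : y² = x³ + 3x`. UNCONDITIONAL
(descent + one rational point of infinite order; no `L`-function, no Heegner point).
[cite: SilvermanAEC2009, Prop. X.6.2(c), Rem. X.6.3] -/
theorem rank_eq_one_and_door_at_two_xCubeAddThreeX :
    (⟨0, 0, 0, ((3 : ℕ) : ℚ), 0⟩ : WeierstrassCurve ℚ).mordellWeilRank = 1 ∧
      (⟨0, 0, 0, ((3 : ℕ) : ℚ), 0⟩ : WeierstrassCurve ℚ).shaCorank 2 = 0 := by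
  haveI := isElliptic_xCubeAddThreeX
  haveI : Fact (Nat.Prime 2) := ⟨Nat.prime_two⟩
  exact ⟨rank_eq_one_and_sha_inf_range_eq_bot_xCubeAddThreeX.1,
    shaCorank_eq_zero_of_forall _ 2 sha_two_torsion_eq_zero_xCubeAddThreeX⟩

/-- **O holds for `E_3 : y² = x³ + 3x`** (rank 1), witness `p₀ = 2`. UNCONDITIONAL. [cite: SilvermanAEC2009, Prop. X.6.2(c)] -/
theorem oneFiniteShaComponent_xCubeAddThreeX :
    ∃ (q : ℕ) (_ : Fact q.Prime), (⟨0, 0, 0, ((3 : ℕ) : ℚ), 0⟩ : WeierstrassCurve ℚ).shaCorank q = 0 :=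
  ⟨2, ⟨Nat.prime_two⟩, rank_eq_one_and_door_at_two_xCubeAddThreeX.2⟩

/-- `corank_{ℤ_2} Sel_{2^∞}(E_3/ℚ) = 1 = rank E_3(ℚ)`: the hypothesis of the rank-1 `2`-converse / of T at the door
prime `2`, certified in the kernel on a rank-1 CM curve. UNCONDITIONAL. [cite: Greenberg1999LNM, §1 pp. 54–57] -/
theorem selmerCorank_two_xCubeAddThreeX_eq_one :
    (⟨0, 0, 0, ((3 : ℕ) : ℚ), 0⟩ : WeierstrassCurve ℚ).selmerCorank 2 = 1 := by
  haveI := isElliptic_xCubeAddThreeX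
  haveI : Fact (Nat.Prime 2) := ⟨Nat.prime_two⟩
  have hid := (⟨0, 0, 0, ((3 : ℕ) : ℚ), 0⟩ : WeierstrassCurve ℚ).selmerCorank_eq_mordellWeilRank_add_holds 2
  obtain ⟨hr, ht⟩ := rank_eq_one_and_door_at_two_xCubeAddThreeX
  omega

/-! ### Rank 2 (Zywina) and the synthesis -/

/-- `(m, n) = (947, 12)` is admissible for Zywina's Theorem 1.2: `947`, `947 + 16·144 = 3251` and `947 + 25·144 = 4547`
are primes `≡ 11 (mod 24)` (a second explicit member of the family; `(659, 12)` is certified in the companion file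
`…RankTwoDoor`). [cite: Zywina2025, Thm. 1.2] -/
theorem zywinaAdmissible_947_12 : ZywinaAdmissible 947 12 :=
  ⟨by norm_num, by norm_num, by norm_num, by norm_num, by norm_num, by norm_num, by norm_num⟩

/-- **For every `r ≤ 2` there is an elliptic `E/ℚ` with `rank E(ℚ) = r` and `t_2(E) = 0`** — UNCONDITIONAL:
`r = 0`: `E_7 : y² = x³ + 7x`; `r = 1`: `E_3 : y² = x³ + 3x`; `r = 2`: Zywina's `E_{947,12}` (tree
`mordellWeilRank_zywinaCurve`, `shaCorank_two_zywinaCurve`). The route's instrument (descent at 2) is certified in the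
kernel at the ranks where O is open; the door's consequence under T (all `t_q = 0`) is certified for no curve of
rank ≥ 2. [cite: SilvermanAEC2009, Cor. X.6.2.1] [cite: Zywina2025, Thm. 1.2] -/
theorem exists_door_at_two_of_le_two (r : ℕ) (hr : r ≤ 2) :
    ∃ W : WeierstrassCurve ℚ, W.IsElliptic ∧ W.mordellWeilRank = r ∧ W.shaCorank 2 = 0 := by
  interval_cases r
  · haveI : Fact (Nat.Prime 7) := ⟨by norm_num⟩
    exact ⟨⟨0, 0, 0, ((7 : ℕ) : ℚ), 0⟩, XCubeAddPX.isElliptic_px 7, door_at_two_xCubeAddPX (Or.inl rfl)⟩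
  · exact ⟨_, isElliptic_xCubeAddThreeX, rank_eq_one_and_door_at_two_xCubeAddThreeX⟩
  · exact ⟨zywinaCurve 947 12, isElliptic_zywinaCurve zywinaAdmissible_947_12,
      mordellWeilRank_zywinaCurve zywinaAdmissible_947_12, shaCorank_two_zywinaCurve zywinaAdmissible_947_12⟩

/-- **O is certified curve by curve at every rank ≤ 2**: for every `r ≤ 2` some elliptic `E/ℚ` of rank `r` satisfies
O (witness prime `2`). UNCONDITIONAL. [cite: SilvermanAEC2009, Cor. X.6.2.1] [cite: Zywina2025, Thm. 1.2] -/
theorem exists_oneFiniteShaComponent_instance_of_le_two (r : ℕ) (hr : r ≤ 2) :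
    ∃ W : WeierstrassCurve ℚ, W.IsElliptic ∧ W.mordellWeilRank = r ∧
      ∃ (q : ℕ) (_ : Fact q.Prime), W.shaCorank q = 0 := by
  obtain ⟨W, hW, hrk, h2⟩ := exists_door_at_two_of_le_two r hr
  exact ⟨W, hW, hrk, 2, ⟨Nat.prime_two⟩, h2⟩

end Summit.BirchSwinnertonDyer.BirchSwinnertonDyer.Theorems.ShaPrimaryTransferKernelDoors
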